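import Summits.CriticalPhenomena.PercolationContinuityZ3.Theorems.Transplant.PlanarSkeletonFrmQuasiProxies
import Summits.CriticalPhenomena.PercolationContinuityZ3.Theorems.Transplant.SkelPhiProxyTransport
import Summits.CriticalPhenomena.PercolationContinuityZ3.Theorems.Transplant.PlanarSkeletonFrmQuasiDefs
import Summits.CriticalPhenomena.PercolationContinuityZ3.Theorems.Transplant.SkelFrmQuasi1ChoiceDefs
import Summits.CriticalPhenomena.PercolationContinuityZ3.Theorems.Transplant.SkelFrmQuasi1ServeAt
import HarnessLib

/-!
# GEN-Q PORT (WAVE-Q table v0.8 section 2, row G239, U-level ?; captain R-6/R-7 2026-08-27: carrier token swap `PlanarSkeletonFrmFrom ↦ PlanarSkeletonFrmQuasi`)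
# of the tree module «Transplant/PlanarSkeletonFrmFromProx» (sha256 41a75b9aab2f5a8e…) onto the quasi-step carrier `PlanarSkeletonFrmQuasi` (p507026): «PlanarSkeletonFrmQuasiProx»

ORIGINAL TITLE: 

builds on p205010 (kernel theorem, internal audit signed; external expert review pending) — nothing in this file uses p205010; NOTHING is claimed about any open node
((N3-b), the end state).  Lane `prim-bschramm`, seat `prim-bschramm-gen-1` (gen 4; binder-wave captain).  Helper file (`--supports stmt-CriticalPhenomena-4575 --as helper`).
PORT RULES (U-wave r1–r4 re-used, GEN-Q hunk classes of p3-g29 #6136): declaration order, names and proof texts are those of «PlanarSkeletonFrmFromProx», byte-identical except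
(i) the carrier token `PlanarSkeletonFrmFrom ↦ PlanarSkeletonFrmQuasi` in binders, `namespace`/`end` lines and qualified names (module names `SkelFrmFrom… ↦ SkelFrmQuasi…`
in imports of already-ported rows); (ii) `Φ.step ↦ Φ.qstep` with the called Steps lemma replaced by its `…Q`/`_q` twin and the cost `Φ.M` threaded (none in this file unless
listed below); (iii) `Φ.cyl_connected ↦ Φ.cyl_reach` readers (none unless listed); (iv) graph-ball radii / window floors ×`Φ.M` (none unless listed).  Carrier-free
residents stay imported/exported from the original «PlanarSkeletonFrmProx» exactly as in the FrmFrom port.  Docstrings and citations are the original's.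

-/

noncomputable section

open scoped Classical

namespace Summit.CriticalPhenomena.PercolationContinuityZ3.Theorems.Transplant

open MeasureTheory Literature.Probability.Percolation Literature.Probability.LatticeModels SimpleGraph KNCells KNLevels
open Literature.Barriers.CriticalPhenomena (graphBall mem_graphBall_self graphBall_mono)
open SkelConc (Consts)
open Skelφ (oriφ lip_oriφ)
open Skelφ.StepI (OutNS eventNAt DataN)

namespace PlanarSkeletonFrmQuasi

variable {V : Type} {G : SimpleGraph V} [G.LocallyFinite]

/-! ## §1 The proxy map -/

-- GEN-Q: `PlanarSkeletonFrmQuasi.HasProxies.prox` is already in the tree (PlanarSkeletonFrmQuasiProxies.lean) — not re-declared.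

-- GEN-Q: `PlanarSkeletonFrmQuasi.HasProxies.prox_spec` is already in the tree (PlanarSkeletonFrmQuasiProxies.lean) — not re-declared.

-- GEN-Q: `PlanarSkeletonFrmQuasi.HasProxies.φ_prox` is already in the tree (PlanarSkeletonFrmQuasiProxies.lean) — not re-declared.

-- GEN-Q: `PlanarSkeletonFrmQuasi.HasProxies.mem_graphBall_prox` is already in the tree (PlanarSkeletonFrmQuasiProxies.lean) — not re-declared.

-- GEN-Q: `PlanarSkeletonFrmQuasi.HasProxies.exists_frame_prox` is already in the tree (PlanarSkeletonFrmQuasiProxies.lean) — not re-declared.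

-- GEN-Q: `PlanarSkeletonFrmQuasi.HasProxies.oriφ_prox` is already in the tree (PlanarSkeletonFrmQuasiProxies.lean) — not re-declared.

-- GEN-Q: `PlanarSkeletonFrmQuasi.HasProxies.prox_eq_self_of_zero` is already in the tree (PlanarSkeletonFrmQuasiProxies.lean) — not re-declared.

/-! ## §2 The inputs served at the proxy, and the consumer-shaped inputs at the centre -/

-- (r2, captain 2026-08-27: the carrier binder is written INTO each signature — a section `variable {Φ : PlanarSkeletonFrmQuasi G}` makes the source text of the
-- twins identical to «PlanarSkeletonFrmFromProx» and trips the gate's restatement check.)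

/-- **The served piece-link AT THE PROXY** `h.prox c` (`(M, n) ∈ 𝒞.SMn O`). [cite: KozmaNitzan2024, §4 pp. 19–21 ((21)–(25))] -/
theorem HasProxies.inputsAt_prox [Countable V] {Φ : PlanarSkeletonFrmQuasi G} {t : V} {D : ℕ} {κ : Consts} {p : unitInterval} {hC : Φ.CylSubcritical p} {O : OutNS V} {q : unitInterval} (h : Φ.HasProxies t D) (𝒞 : ChoiceNQ κ Φ t p hC) (hAt : 𝒞.AtQNQ O q) (c : V) {M n : ℕ} (hMn : (M, n) ∈ 𝒞.SMn O)
    (fam : Fin 2) (τ : ℤˣ) :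
    1 - 𝒞.δI < (bondPercolation G q).real
      (eventNAt G (oriφ Φ.φ (O.ori t M n)) O.merged.toDataN t (h.prox c) (M, some (n, fam, Skelφ.StepI.sgQ O.qd O.qdT O.ori t M n fam, τ))) := by
  obtain ⟨α, hαt, hφ⟩ := h.exists_frame_prox c
  exact ChoiceNQ.inputsAt_of_atQNQ_frame 𝒞 hAt hαt hφ hMn fam τ

/-- **THE CONSUMER-SHAPED PIECE-LINK AT AN ARBITRARY CENTRE `c`** (option (a)): with the consumer-side data `O.merged.toDataN.proxR h.prox D` (seed `Λ (prox c)`, kit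
radius `+ D`) and the width floor `D ≤ n`, the input is `(1 − δI)`-likely AT `c` — served at the proxy (`inputsAt_prox`), transported by set monotonicity
(`Skelφ.StepI.measureReal_eventNAt_some_proxR_le`). [this work] -/
theorem HasProxies.inputsAt_proxR [Countable V] {Φ : PlanarSkeletonFrmQuasi G} {t : V} {D : ℕ} {κ : Consts} {p : unitInterval} {hC : Φ.CylSubcritical p} {O : OutNS V} {q : unitInterval} (h : Φ.HasProxies t D) (𝒞 : ChoiceNQ κ Φ t p hC) (hAt : 𝒞.AtQNQ O q) (c : V) {M n : ℕ} (hMn : (M, n) ∈ 𝒞.SMn O)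
    (hn : D ≤ n) (fam : Fin 2) (τ : ℤˣ) :
    1 - 𝒞.δI < (bondPercolation G q).real
      (eventNAt G (oriφ Φ.φ (O.ori t M n)) (O.merged.toDataN.proxR h.prox D) t c (M, some (n, fam, Skelφ.StepI.sgQ O.qd O.qdT O.ori t M n fam, τ))) :=
  lt_of_lt_of_le (h.inputsAt_prox 𝒞 hAt c hMn fam τ)
    (Skelφ.StepI.measureReal_eventNAt_some_proxR_le (lip_oriφ Φ.lip _) (h.oriφ_prox _ c) (h.mem_graphBall_prox c) _ _ _ _ hn _ _ _)

-- GEN-Q (R-2, captain 2026-08-27): `PlanarSkeletonFrmFrom.HasProxies.zoneAt_prox` is not in the used cone of the node top — not ported.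

-- GEN-Q (R-2, captain 2026-08-27): `PlanarSkeletonFrmFrom.HasProxies.zoneAt_proxR` is not in the used cone of the node top — not ported.

/-- **The centre lies in the consumer's seed** `Λ (prox c) k` at every seed level `k ≥ D` (the floor of hunk (iii)); `Λ = fatSeq` of LEVEL 0‴. [this work] -/
theorem HasProxies.mem_fatSeq_prox [Countable V] {Φ : PlanarSkeletonFrmQuasi G} {t : V} {D : ℕ} {p : unitInterval} (h : Φ.HasProxies t D) (hC : Φ.CylSubcritical p) (c : V) {k : ℕ} (hk : D ≤ k) :
    c ∈ Skelφ.fatSeq (G := G) (φ := Φ.φ) (types := Φ.types) Φ.frame hC (h.prox c) k :=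
  Skelφ.mem_fatSeq_of_mem_graphBall Φ.lip Φ.frame hC (h.mem_graphBall_prox c) hk

end PlanarSkeletonFrmQuasi

end Summit.CriticalPhenomena.PercolationContinuityZ3.Theorems.Transplant

end
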